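import Summits.ResolutionOfSingularities.ResolutionOfSingularities.Theorems.MarkedTransferCampaignW46WWalkModel
import Mathlib.Data.Nat.Choose.Vandermonde
import HarnessLib

/-!
# [OURS · L1 W4.6 rung (iii-2)] THE W-WALK LAWS: the `t`-layer `d − p` of the transform, no increase of the shade, the stall
# structure, adaptedness, and the sharp-vertical drop — for ARBITRARY residuals `f ∈ K⟦t, y, z⟧` (no purity, no window needed
# beyond `p + 1 ≤ d ≤ 2p − 1`)

Cell `res-hironaka`, LADDER-RESOLUTION rung L (D-0089), slot W4.6 rung (iii); seat res-L1-s46-pv-5 (gen 6), plan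
`HOME/L/res-L1-s46-pv-5/W-WALK-PLAN.md` §1. Host route MarkedTransfer, `--supports stmt-ResolutionOfSingularities-16155 --as helper`;
kind proof (no definition). Everything is a statement about the coefficientwise model of `…WWalkModel.lean`.

STATE: `f` with `BDiv r_t r_y f` (every monomial divisible by `t^{r_t} y^{r_y}`), `LowVanish d f` (order `≥ d`), `p + 1 ≤ d ≤ 2p − 1`;
`σ := d − r_t − r_y` is the SHADE (order of `G`, `f = t^{r_t} y^{r_y} G`). Write `φ(a,b,c)` for the coefficient of `t^a y^b z^c`, `a+b+c = d`.
* §1 THE LAYER `t^{d−p}` OF THE TRANSFORM: `[t^{d−p} y^i z^c] (stepT p l γ f) = P_{i,c} := Σ_b C(b,i) l^{b−i} φ(d−b−c, b, c)` for every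
  cleaning root `γ` (the cleaning monomial `t^p` and the shear `z ↦ z − γt` never touch this layer since `d < 2p` and the transform lies in
  `(t^{d−p})`); at `l = 0`: `P_{i,c} = φ(d−i−c, i, c)`.
* §2 `l = 0` (direction `(1:0:0)`, the old `y`-letter kept): NO INCREASE `σ′ ≤ σ − (a₀ − r_t)` where `a₀` is the largest `t`-exponent on the
  degree-`d` layer (witness monomial `t^{d−p} y^{b₀} z^{c₀}`); STALL ⇒ the layer is `T^{r_t}·H(Y,Z)` and `YAdapted` transfers parent ↔ child,
  `NDz ⇒ YAdapted`; `TAdapted` parent ⇒ `σ′ = 0` (the direction `(1:0:0)` is off the residual cone except at the `T^σ`-corner).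
* §3 `l ≠ 0` (free direction, the `y`-letter lost): Vandermonde convolution `P_{i,c} = Σ_j C(r_y,j) l^{r_y−j} P̃_{i−j,c}` with the
  TWISTED RESIDUE COEFFICIENTS `P̃ = pcoef` of the model file (`P = (y+l)^{r_y}·P̃`); `P̃ ≠ 0` with a nonzero coefficient of weight `≤ σ`;
  at a lowest nonzero `P̃_{i,c}`: `P_{i,c} = l^{r_y} P̃_{i,c} ≠ 0` ⇒ NO INCREASE `σ′ ≤ σ`; STALL ⇒ `P̃_{i,c} = 0` below weight `σ` and
  `[t^{d−p} y^σ] f′ = l^{r_y} φ(r_t, r_y + σ, 0)`: `YAdapted` transfers and `NDz ⇒ YAdapted`.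
The sharp-vertical step is `stepT p 0 γ ∘ swapTY` (model file): its laws are §2 with `r_t ↔ r_y`, `TAdapted ↔ YAdapted`.

HONEST FRAMING. OURS; nothing here is a statement of H. Hironaka's manuscript [Hironaka2017] and nothing of it is used. AI-written;
AI review is weaker than expert review. No `sorry`; axioms standard. Reference for the chart formulas: [Hauser2010] §§F–G.
-/

noncomputable section

set_option linter.dupNamespace false -- mandated namespace of this single-conjunct summit

open MvPowerSeries Finset

namespace Summit.ResolutionOfSingularities.ResolutionOfSingularities.Theorems

namespace CampaignW46

namespace WWalk

variable {K : Type*} [Field K]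

/-! ## §1 The layer `t^{d−p}` of the transform -/

/-- The one-letter residue coefficients `P_{i,c}(l) = Σ_b C(b,i) l^{b−i} φ(d−b−c, b, c)` of the degree-`d` layer of `f`. [folklore] -/
def layerP (d : ℕ) (l : K) (f : MvPowerSeries (Option (Fin 2)) K) (i c : ℕ) : K :=
  ∑ b ∈ range (d + 1), if b + c ≤ d then (b.choose i : K) * l ^ (b - i) * coeff (mk3 (d - b - c) b c) f else 0

/-- **The `t^{d−p}`-layer of the chart transform is `P`**: `[t^{d−p} y^i z^c] (chartT p l f) = P_{i,c}(l)`. [cite: Hauser2010, §F] -/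
theorem coeff_chartT_layer {p d : ℕ} (hpd : p ≤ d) (l : K) (f : MvPowerSeries (Option (Fin 2)) K) (i c : ℕ) :
    coeff (mk3 (d - p) i c) (chartT p l f) = layerP d l f i c := by
  rw [coeff_chartT, layerP, Nat.sub_add_cancel hpd]

/-- **The `t^{d−p}`-layer of the STEP is `P`** (any cleaning root `γ`): the cleaning monomial `t^p` is not on the layer (`d ≤ 2p − 1`) and the
shear `z ↦ z − γt` feeds the layer only from lower `t`-layers, which are empty (`LowVanish d f`). [cite: Hauser2010, §§F–G] -/
theorem coeff_stepT_layer {p d : ℕ} (hpd : p + 1 ≤ d) (hd2 : d ≤ 2 * p - 1) (l γ : K) {f : MvPowerSeries (Option (Fin 2)) K}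
    (hlow : LowVanish d f) (i c : ℕ) : coeff (mk3 (d - p) i c) (stepT p l γ f) = layerP d l f i c := by
  rw [stepT, coeff_shearZ, sum_eq_single 0]
  · rw [Nat.choose_zero_right, Nat.cast_one, pow_zero, one_mul, one_mul, Nat.sub_zero, Nat.add_zero, map_sub,
      coeff_C_mul_X_pow, coeff_chartT_layer (by omega) l f i c]
    have : ¬ (d - p = p ∧ i = 0 ∧ c = 0) := by omega
    rw [if_neg this, sub_zero]
  · intro k hk hk0
    rw [map_sub, coeff_C_mul_X_pow, coeff_chartT_eq_zero_of_lt hlow (by rw [mem_range] at hk; omega)]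
    have : ¬ (d - p - k = p ∧ i = 0 ∧ c + k = 0) := by omega
    rw [if_neg this, sub_zero, mul_zero]
  · intro h; exact absurd (mem_range.mpr (Nat.zero_lt_succ _)) h

/-- At `l = 0` the layer coefficient is a single coefficient of `f`: `P_{i,c}(0) = φ(d−i−c, i, c)` (for `i + c ≤ d`). [folklore] -/
theorem layerP_zero {d : ℕ} (f : MvPowerSeries (Option (Fin 2)) K) {i c : ℕ} (hic : i + c ≤ d) :
    layerP d (0 : K) f i c = coeff (mk3 (d - i - c) i c) f := by
  rw [layerP, sum_eq_single i]
  · rw [if_pos (by omega), Nat.choose_self, Nat.cast_one, Nat.sub_self, pow_zero, one_mul, one_mul]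
  · intro b hb hbi
    split_ifs with h
    · by_cases hlt : i < b
      · have : b - i ≠ 0 := by omega
        rw [zero_pow this, mul_zero, zero_mul]
      · rw [Nat.choose_eq_zero_of_lt (by omega), Nat.cast_zero, zero_mul, zero_mul]
    · rfl
  · intro h; exact absurd (mem_range.mpr (by omega)) h

/-! ## §2 The direction `(1 : 0 : 0)` (`l = 0`): the kept letter, no increase, stall structure, the `T`-adapted drop -/

section DirectionZero

variable {p d rt ry : ℕ} {γ : K} {f : MvPowerSeries (Option (Fin 2)) K}

/-- **Witness of NO INCREASE at `l = 0`**: if `t^{a₀} y^{b₀} z^{c₀}` (degree `d`) occurs in `f` then `t^{d−p} y^{b₀} z^{c₀}` occurs in the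
transform — so `ord f′ ≤ d − p + b₀ + c₀ = d − p + (d − a₀)` and the new shade `σ′ = ord f′ − (d−p) − r_y ≤ σ − (a₀ − r_t)`.
[cite: Hauser2010, §F (behaviour of the shade under blowup)] -/
theorem coeff_stepT_zero_ne_zero (hpd : p + 1 ≤ d) (hd2 : d ≤ 2 * p - 1) (hlow : LowVanish d f) {a₀ b₀ c₀ : ℕ}
    (hdeg : a₀ + b₀ + c₀ = d) (hne : coeff (mk3 a₀ b₀ c₀) f ≠ 0) :
    coeff (mk3 (d - p) b₀ c₀) (stepT p 0 γ f) ≠ 0 := by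
  rw [coeff_stepT_layer hpd hd2 0 γ hlow, layerP_zero f (by omega), show d - b₀ - c₀ = a₀ by omega]
  exact hne

/-- **STALL STRUCTURE at `l = 0`**: if the transform has no monomial of degree `< d − p + r_y + σ` (`σ = d − r_t − r_y`; i.e. the
shade did not drop) then every monomial of the degree-`d` layer of `f` has `t`-exponent exactly `r_t` (the residual cone is `T`-free).
[cite: Hauser2010, §F] -/
theorem texp_eq_of_stall_zero (hpd : p + 1 ≤ d) (hd2 : d ≤ 2 * p - 1) (hlow : LowVanish d f) (hB : BDiv rt ry f)
    (hstall : LowVanish (d - p + (d - rt)) (stepT p 0 γ f)) {a b c : ℕ} (hdeg : a + b + c = d) (hne : coeff (mk3 a b c) f ≠ 0) :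
    a = rt := by
  have hrt : rt ≤ a := by simpa using (hB _ hne).1
  by_contra hne'
  have hlt : rt < a := lt_of_le_of_ne hrt (Ne.symm hne')
  have h := coeff_stepT_zero_ne_zero (γ := γ) hpd hd2 hlow hdeg hne
  exact h (hstall _ (by rw [degree_mk3]; omega))

/-- **`YAdapted` transfers through a stall at `l = 0`** (parent ↔ child; child read with boundary `r_t′ = d − p`, order `d′ = d − p + r_y + σ`). [folklore] -/
theorem yAdapted_stepT_zero_iff (hpd : p + 1 ≤ d) (hd2 : d ≤ 2 * p - 1) (hlow : LowVanish d f) (hrt : rt + ry ≤ d) :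
    YAdapted (d - p) (d - p + (d - rt)) (stepT p 0 γ f) ↔ YAdapted rt d f := by
  rw [YAdapted, YAdapted, show d - p + (d - rt) - (d - p) = d - rt by omega, coeff_stepT_layer hpd hd2 0 γ hlow,
    layerP_zero f (by omega), show d - (d - rt) - 0 = rt by omega]

/-- **(ND) ⇒ `YAdapted` at a stall with `l = 0`**: a `z`-free monomial of the layer has `t`-exponent `r_t`, so it is the corner
`t^{r_t} y^{d − r_t}`. [folklore] -/
theorem yAdapted_of_ndz_of_stall_zero (hpd : p + 1 ≤ d) (hd2 : d ≤ 2 * p - 1) (hlow : LowVanish d f) (hB : BDiv rt ry f)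
    (hstall : LowVanish (d - p + (d - rt)) (stepT p 0 γ f)) (hnd : NDz d f) : YAdapted rt d f := by
  obtain ⟨a, b, hab, hne⟩ := hnd
  have ha := texp_eq_of_stall_zero hpd hd2 hlow hB hstall (by omega : a + b + 0 = d) hne
  subst ha
  rw [YAdapted, show d - a = b by omega]
  exact hne

/-- **The `T`-ADAPTED DROP**: if the corner `t^{d − r_y} y^{r_y}` occurs in `f` (`TAdapted`), then `t^{d−p} y^{r_y}` occurs in the transform at
`l = 0` — the new shade is `0`. Read on the swapped state this is «from a `y`-adapted state the SHARP-VERTICAL step kills the shade».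
[cite: Hauser2010, §F] -/
theorem coeff_stepT_zero_corner_ne_zero (hpd : p + 1 ≤ d) (hd2 : d ≤ 2 * p - 1) (hlow : LowVanish d f) (hry : ry ≤ d)
    (hT : TAdapted ry d f) : coeff (mk3 (d - p) ry 0) (stepT p 0 γ f) ≠ 0 :=
  coeff_stepT_zero_ne_zero hpd hd2 hlow (by omega : (d - ry) + ry + 0 = d) hT

end DirectionZero

/-! ## §3 The free directions `(1 : l : 0)`, `l ≠ 0`: Vandermonde convolution with the twisted residue coefficients -/

section DirectionFree

variable {p d rt ry : ℕ} {l γ : K} {f : MvPowerSeries (Option (Fin 2)) K}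

/-- Vandermonde, termwise with the powers of `l`: `C(b'+r, i) l^{b'+r−i} = Σ_{j ≤ i} C(r,j) l^{r−j} · C(b', i−j) l^{b'−(i−j)}`. [folklore] -/
theorem choose_add_mul_pow_eq_sum (r b' i : ℕ) (l : K) :
    ((b' + r).choose i : K) * l ^ (b' + r - i) =
      ∑ j ∈ range (i + 1), (r.choose j : K) * l ^ (r - j) * ((b'.choose (i - j) : K) * l ^ (b' - (i - j))) := by
  have hV : ((b' + r).choose i : K) = ∑ j ∈ range (i + 1), (r.choose j : K) * (b'.choose (i - j) : K) := by
    rw [add_comm, Nat.add_choose_eq, Finset.Nat.sum_antidiagonal_eq_sum_range_succ (fun j k => r.choose j * b'.choose k) i]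
    push_cast
    rfl
  rw [hV, sum_mul]
  refine sum_congr rfl fun j hj => ?_
  rw [mem_range] at hj
  by_cases hjr : j ≤ r
  · by_cases hk : i - j ≤ b'
    · have : b' + r - i = (r - j) + (b' - (i - j)) := by omega
      rw [this, pow_add]; ring
    · rw [Nat.choose_eq_zero_of_lt (by omega : b' < i - j), Nat.cast_zero]; ring
  · rw [Nat.choose_eq_zero_of_lt (by omega : r < j), Nat.cast_zero]; ring

/-- **CONVOLUTION `P = (y + l)^{r_y} · P̃`**: under `BDiv r_t r_y f`,
`P_{i,c}(l) = Σ_{j ≤ i} C(r_y, j) l^{r_y − j} P̃_{i−j,c}(l)` (`P̃ = pcoef r_y d l f`). [folklore] -/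
theorem layerP_eq_sum_pcoef (hB : BDiv rt ry f) (i c : ℕ) :
    layerP d l f i c = ∑ j ∈ range (i + 1), (ry.choose j : K) * l ^ (ry - j) * pcoef ry d l f (i - j) c := by
  classical
  -- right-hand side as a double sum, then swap
  have hR : ∑ j ∈ range (i + 1), (ry.choose j : K) * l ^ (ry - j) * pcoef ry d l f (i - j) c =
      ∑ b' ∈ range (d + 1), ∑ j ∈ range (i + 1), if ry + b' + c ≤ d then
        (ry.choose j : K) * l ^ (ry - j) * ((b'.choose (i - j) : K) * l ^ (b' - (i - j))) *
          coeff (mk3 (d - ry - b' - c) (b' + ry) c) f else 0 := by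
    rw [sum_comm]
    refine sum_congr rfl fun j _ => ?_
    rw [pcoef, mul_sum]
    refine sum_congr rfl fun b' _ => ?_
    split_ifs with h
    · ring
    · rw [mul_zero]
  rw [hR]
  -- collapse the inner sums by Vandermonde
  have hV : ∀ b' ∈ range (d + 1), (∑ j ∈ range (i + 1), if ry + b' + c ≤ d then
        (ry.choose j : K) * l ^ (ry - j) * ((b'.choose (i - j) : K) * l ^ (b' - (i - j))) *
          coeff (mk3 (d - ry - b' - c) (b' + ry) c) f else 0) =
      if ry + b' + c ≤ d then ((b' + ry).choose i : K) * l ^ (b' + ry - i) * coeff (mk3 (d - ry - b' - c) (b' + ry) c) f else 0 := by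
    intro b' _
    split_ifs with h
    · rw [choose_add_mul_pow_eq_sum, sum_mul]
    · exact sum_const_zero
  rw [sum_congr rfl hV, layerP]
  -- reindex the left-hand side by `b = b' + r_y` (terms with `b < r_y` vanish by `BDiv`)
  symm
  refine sum_bij_ne_zero (fun b' _ _ => b' + ry) (fun b' hb' hne => ?_) (fun b₁ _ _ b₂ _ _ h => by omega)
    (fun b hb hne => ?_) (fun b' hb' hne => ?_)
  · rw [mem_range]
    have : ry + b' + c ≤ d := by by_contra h; rw [if_neg h] at hne; exact hne rfl
    omega
  · have hguard : b + c ≤ d := by by_contra h; rw [if_neg h] at hne; exact hne rfl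
    rw [if_pos hguard] at hne
    have hφ : coeff (mk3 (d - b - c) b c) f ≠ 0 := fun h0 => hne (by rw [h0, mul_zero])
    have hb : ry ≤ b := by simpa using (hB _ hφ).2
    refine ⟨b - ry, mem_range.mpr (by omega), ?_, by omega⟩
    rw [if_pos (by omega : ry + (b - ry) + c ≤ d), show b - ry + ry = b by omega,
      show d - ry - (b - ry) - c = d - b - c by omega]
    exact hne
  · have hguard : ry + b' + c ≤ d := by by_contra h; rw [if_neg h] at hne; exact hne rfl
    rw [if_pos hguard, if_pos (by omega : b' + ry + c ≤ d), show d - (b' + ry) - c = d - ry - b' - c by omega]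

/-- **`P̃ ≠ 0` with a nonzero coefficient of weight `≤ σ`**: if `f` has a monomial of degree `d` (all of them divisible by
`t^{r_t} y^{r_y}`), then some `P̃_{i,c} ≠ 0` with `i + c ≤ σ = d − r_t − r_y` (the top `y`-exponent in a `z`-column of the layer gives a
single-term sum). [folklore] -/
theorem exists_pcoef_ne_zero (hB : BDiv rt ry f) {a₀ b₀ c₀ : ℕ} (hdeg : a₀ + b₀ + c₀ = d) (hne : coeff (mk3 a₀ b₀ c₀) f ≠ 0) :
    ∃ i c, i + c ≤ d - rt - ry ∧ pcoef ry d l f i c ≠ 0 := by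
  classical
  -- the nonempty set of `b'` with `φ(d - r_y - b' - c₀, b' + r_y, c₀) ≠ 0`, and its maximum
  set S := (range (d + 1)).filter (fun b' => ry + b' + c₀ ≤ d ∧ coeff (mk3 (d - ry - b' - c₀) (b' + ry) c₀) f ≠ 0) with hS
  have hb₀ : rt ≤ a₀ ∧ ry ≤ b₀ := by simpa using hB _ hne
  have hmem : b₀ - ry ∈ S := by
    rw [hS, mem_filter, mem_range]
    refine ⟨by omega, by omega, ?_⟩
    rw [show d - ry - (b₀ - ry) - c₀ = a₀ by omega, show b₀ - ry + ry = b₀ by omega]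
    exact hne
  have hSne : S.Nonempty := ⟨_, hmem⟩
  set m := S.max' hSne with hm
  have hmS : m ∈ S := S.max'_mem hSne
  rw [hS, mem_filter, mem_range] at hmS
  obtain ⟨-, hmd, hmne⟩ := hmS
  refine ⟨m, c₀, ?_, ?_⟩
  · have := (hB _ hmne).1; simp at this; omega
  · rw [pcoef, sum_eq_single m]
    · rw [if_pos hmd, Nat.choose_self, Nat.cast_one, Nat.sub_self, pow_zero, one_mul, one_mul]
      exact hmne
    · intro b hb hbm
      split_ifs with h
      · rcases lt_or_gt_of_ne hbm with hlt | hgt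
        · rw [Nat.choose_eq_zero_of_lt hlt, Nat.cast_zero, zero_mul, zero_mul]
        · -- `b > m`: the coefficient vanishes by maximality
          by_cases h0 : coeff (mk3 (d - ry - b - c₀) (b + ry) c₀) f = 0
          · rw [h0, mul_zero]
          · exfalso
            have hbS : b ∈ S := by rw [hS, mem_filter]; exact ⟨hb, h, h0⟩
            exact absurd (S.le_max' b hbS) (by rw [← hm]; omega)
      · rfl
    · intro h; exact absurd (mem_range.mpr (by omega)) h

/-- **Lowest term of `P = (y+l)^{r_y} P̃`**: at a nonzero `P̃_{i,c}` of minimal weight `i + c`, `P_{i,c} = l^{r_y} P̃_{i,c}`. [folklore] -/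
theorem layerP_eq_of_minimal (hB : BDiv rt ry f) {i c : ℕ} (hmin : ∀ i' c', i' + c' < i + c → pcoef ry d l f i' c' = 0) :
    layerP d l f i c = l ^ ry * pcoef ry d l f i c := by
  rw [layerP_eq_sum_pcoef hB, sum_eq_single 0]
  · rw [Nat.choose_zero_right, Nat.cast_one, one_mul, Nat.sub_zero, Nat.sub_zero]
  · intro j hj hj0
    rw [mem_range] at hj
    rw [hmin (i - j) c (by omega), mul_zero]
  · intro h; exact absurd (mem_range.mpr (Nat.zero_lt_succ _)) h

/-- **NO INCREASE at a free direction**: for `l ≠ 0` (or no `y`-letter) the transform has a monomial `t^{d−p} y^i z^c` with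
`i + c ≤ σ = d − r_t − r_y` — so `ord f′ ≤ (d − p) + σ` and the new shade (`r_y′ = 0`) is `≤ σ`. [cite: Hauser2010, §F (behaviour of the
shade under blowup)] -/
theorem exists_coeff_stepT_ne_zero (hpd : p + 1 ≤ d) (hd2 : d ≤ 2 * p - 1) (hlow : LowVanish d f) (hB : BDiv rt ry f)
    (hl : l ≠ 0 ∨ ry = 0) {a₀ b₀ c₀ : ℕ} (hdeg : a₀ + b₀ + c₀ = d) (hne : coeff (mk3 a₀ b₀ c₀) f ≠ 0) :
    ∃ i c, i + c ≤ d - rt - ry ∧ coeff (mk3 (d - p) i c) (stepT p l γ f) ≠ 0 := by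
  classical
  -- a nonzero `P̃` of minimal weight
  have hex : ∃ w, ∃ i c, i + c = w ∧ pcoef ry d l f i c ≠ 0 := by
    obtain ⟨i, c, -, h⟩ := exists_pcoef_ne_zero (l := l) hB hdeg hne
    exact ⟨i + c, i, c, rfl, h⟩
  obtain ⟨i, c, hw, hic⟩ := Nat.find_spec hex
  have hmin : ∀ i' c', i' + c' < i + c → pcoef ry d l f i' c' = 0 := by
    intro i' c' hlt
    by_contra h
    exact Nat.find_min hex (hw ▸ hlt) ⟨i', c', rfl, h⟩
  obtain ⟨i₁, c₁, hle₁, h₁⟩ := exists_pcoef_ne_zero (l := l) hB hdeg hne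
  have hle : i + c ≤ d - rt - ry := by
    have := Nat.find_min' hex ⟨i₁, c₁, rfl, h₁⟩
    omega
  refine ⟨i, c, hle, ?_⟩
  rw [coeff_stepT_layer hpd hd2 l γ hlow, layerP_eq_of_minimal hB hmin]
  refine mul_ne_zero ?_ hic
  rcases hl with hl | hry
  · exact pow_ne_zero _ hl
  · rw [hry, pow_zero]; exact one_ne_zero

/-- **STALL ⇒ `P̃` vanishes below weight `σ`**: if the transform has no monomial of degree `< (d − p) + σ` then `P̃_{i,c} = 0` for
`i + c < σ` (`l ≠ 0` or no `y`-letter). [folklore] -/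
theorem pcoef_eq_zero_of_stall (hpd : p + 1 ≤ d) (hd2 : d ≤ 2 * p - 1) (hlow : LowVanish d f) (hB : BDiv rt ry f)
    (hl : l ≠ 0 ∨ ry = 0) (hstall : LowVanish (d - p + (d - rt - ry)) (stepT p l γ f)) {i c : ℕ} (hic : i + c < d - rt - ry) :
    pcoef ry d l f i c = 0 := by
  classical
  by_contra hne
  have hex : ∃ w, ∃ i c, i + c = w ∧ pcoef ry d l f i c ≠ 0 := ⟨i + c, i, c, rfl, hne⟩
  obtain ⟨i₀, c₀, hw, h₀⟩ := Nat.find_spec hex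
  have hmin : ∀ i' c', i' + c' < i₀ + c₀ → pcoef ry d l f i' c' = 0 := by
    intro i' c' hlt
    by_contra h
    exact Nat.find_min hex (hw ▸ hlt) ⟨i', c', rfl, h⟩
  have hle : i₀ + c₀ ≤ i + c := by
    have := Nat.find_min' hex ⟨i, c, rfl, hne⟩; omega
  have hcoef : coeff (mk3 (d - p) i₀ c₀) (stepT p l γ f) ≠ 0 := by
    rw [coeff_stepT_layer hpd hd2 l γ hlow, layerP_eq_of_minimal hB hmin]
    refine mul_ne_zero ?_ h₀
    rcases hl with hl | hry
    · exact pow_ne_zero _ hl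
    · rw [hry, pow_zero]; exact one_ne_zero
  exact hcoef (hstall _ (by rw [degree_mk3]; omega))

/-- **STALL ⇒ the `Y^σ`-corner of the child is `l^{r_y}` times the `Y^σ`-corner of the parent**:
`[t^{d−p} y^σ] f′ = l^{r_y} · φ(r_t, r_y + σ, 0)`. [folklore] -/
theorem coeff_stepT_corner_of_stall (hpd : p + 1 ≤ d) (hd2 : d ≤ 2 * p - 1) (hlow : LowVanish d f) (hB : BDiv rt ry f)
    (hrt : rt + ry ≤ d) (hl : l ≠ 0 ∨ ry = 0) (hstall : LowVanish (d - p + (d - rt - ry)) (stepT p l γ f)) :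
    coeff (mk3 (d - p) (d - rt - ry) 0) (stepT p l γ f) = l ^ ry * coeff (mk3 rt (d - rt) 0) f := by
  classical
  rw [coeff_stepT_layer hpd hd2 l γ hlow, layerP_eq_of_minimal hB (fun i' c' h => pcoef_eq_zero_of_stall hpd hd2 hlow hB hl hstall h)]
  congr 1
  rw [pcoef, sum_eq_single (d - rt - ry)]
  · rw [if_pos (by omega), Nat.choose_self, Nat.cast_one, Nat.sub_self, pow_zero, one_mul, one_mul,
      show d - ry - (d - rt - ry) - 0 = rt by omega, show d - rt - ry + ry = d - rt by omega]
  · intro b hb hbσ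
    split_ifs with h
    · rcases lt_or_gt_of_ne hbσ with hlt | hgt
      · rw [Nat.choose_eq_zero_of_lt hlt, Nat.cast_zero, zero_mul, zero_mul]
      · by_cases h0 : coeff (mk3 (d - ry - b - 0) (b + ry) 0) f = 0
        · rw [h0, mul_zero]
        · have := (hB _ h0).1; simp at this; omega
    · rfl
  · intro h; exact absurd (mem_range.mpr (by omega)) h

/-- **`YAdapted` transfers through a free stall** (child boundary `r_t′ = d − p`, `r_y′ = 0`, order `d′ = (d − p) + σ`). [folklore] -/
theorem yAdapted_stepT_iff_of_stall (hpd : p + 1 ≤ d) (hd2 : d ≤ 2 * p - 1) (hlow : LowVanish d f) (hB : BDiv rt ry f)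
    (hrt : rt + ry ≤ d) (hl : l ≠ 0) (hstall : LowVanish (d - p + (d - rt - ry)) (stepT p l γ f)) :
    YAdapted (d - p) (d - p + (d - rt - ry)) (stepT p l γ f) ↔ YAdapted rt d f := by
  rw [YAdapted, YAdapted, show d - p + (d - rt - ry) - (d - p) = d - rt - ry by omega,
    coeff_stepT_corner_of_stall hpd hd2 hlow hB hrt (Or.inl hl) hstall]
  rw [mul_ne_zero_iff]
  exact ⟨fun h => h.2, fun h => ⟨pow_ne_zero _ hl, h⟩⟩

/-- **(ND) ⇒ `YAdapted` at a free stall**: a `z`-free monomial of the layer with the largest `y`-exponent gives a single-term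
`P̃_{b′,0} ≠ 0`, whose weight must be `≥ σ` by the stall — so it is the corner `t^{r_t} y^{r_y + σ}`. [folklore] -/
theorem yAdapted_of_ndz_of_stall (hpd : p + 1 ≤ d) (hd2 : d ≤ 2 * p - 1) (hlow : LowVanish d f) (hB : BDiv rt ry f)
    (hl : l ≠ 0 ∨ ry = 0) (hstall : LowVanish (d - p + (d - rt - ry)) (stepT p l γ f)) (hnd : NDz d f) :
    YAdapted rt d f := by
  classical
  obtain ⟨a, b, hab, hne⟩ := hnd
  -- the maximal `b'` with `φ(d - r_y - b', b' + r_y, 0) ≠ 0`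
  set S := (range (d + 1)).filter (fun b' => ry + b' ≤ d ∧ coeff (mk3 (d - ry - b') (b' + ry) 0) f ≠ 0) with hS
  have hb : rt ≤ a ∧ ry ≤ b := by simpa using hB _ hne
  have hmem : b - ry ∈ S := by
    rw [hS, mem_filter, mem_range]
    refine ⟨by omega, by omega, ?_⟩
    rw [show d - ry - (b - ry) = a by omega, show b - ry + ry = b by omega]; exact hne
  have hSne : S.Nonempty := ⟨_, hmem⟩
  set m := S.max' hSne with hm
  have hmS : m ∈ S := S.max'_mem hSne
  rw [hS, mem_filter, mem_range] at hmS
  obtain ⟨-, hmd, hmne⟩ := hmS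
  -- single-term `P̃_{m,0}`
  have hsingle : pcoef ry d l f m 0 = coeff (mk3 (d - ry - m) (m + ry) 0) f := by
    rw [pcoef, sum_eq_single m]
    · rw [if_pos (by omega), Nat.choose_self, Nat.cast_one, Nat.sub_self, pow_zero, one_mul, one_mul, Nat.sub_zero]
    · intro b' hb' hbm
      split_ifs with h
      · rcases lt_or_gt_of_ne hbm with hlt | hgt
        · rw [Nat.choose_eq_zero_of_lt hlt, Nat.cast_zero, zero_mul, zero_mul]
        · by_cases h0 : coeff (mk3 (d - ry - b' - 0) (b' + ry) 0) f = 0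
          · rw [h0, mul_zero]
          · exfalso
            have hbS : b' ∈ S := by
              rw [hS, mem_filter]; exact ⟨hb', by omega, by rwa [Nat.sub_zero] at h0⟩
            have := S.le_max' b' hbS
            rw [← hm] at this
            omega
      · rfl
    · intro h; exact absurd (mem_range.mpr (by omega)) h
  -- `m ≤ σ` by `BDiv`, `m ≥ σ` by the stall
  have hmle : m ≤ d - rt - ry := by have := (hB _ hmne).1; simp at this; omega
  have hmge : d - rt - ry ≤ m := by
    by_contra hlt
    push Not at hlt
    have h0 := pcoef_eq_zero_of_stall hpd hd2 hlow hB hl hstall (by omega : m + 0 < d - rt - ry)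
    rw [hsingle] at h0
    exact hmne h0
  have hmeq : m = d - rt - ry := le_antisymm hmle hmge
  rw [YAdapted, show d - rt = m + ry by omega, show rt = d - ry - m by omega]
  exact hmne

end DirectionFree

end WWalk

end CampaignW46

end Summit.ResolutionOfSingularities.ResolutionOfSingularities.Theorems

end
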